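import Literature.NumberTheory.EllipticCurves.CuspFormTwist
import Literature.NumberTheory.EllipticCurves.ModularSymbolsProofs
import HarnessLib

/-!
# Modular symbols of the twisted cusp form: `{∞, r}_{f_χ} = g(χ)⁻¹ ∑_{u mod m} χ(u) {∞, r + u/m}_f`
# (Shimura 1971, Prop. 3.64 at the level of modular symbols; Mazur–Tate–Teitelbaum 1986, §I.8)

For a cusp form `f ∈ S₂(Γ₀(N))` and a QUADRATIC Dirichlet character `χ` modulo `m`, the tree's twist
`charTwist L hN hm hχ f ∈ S₂(Γ₀(L))` (`N ∣ L`, `m² ∣ L`; file `CuspFormTwist`) is the function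
`f_χ(τ) = g(χ)⁻¹ ∑_{u mod m} χ(u) f(τ + u/m)` (Shimura 1971, Prop. 3.64; `χ⁻¹ = χ`, and for primitive
`χ` its `q`-expansion is `∑ χ(n) aₙ(f) qⁿ`, `cuspCoeff_charTwist`). Integrating along the vertical ray
above a rational cusp `r` (the tree's `modularSymbol f r = {∞, r}_f = 2π ∫₀^∞ f(r + it) dt`,
Manin 1972 §1.5) gives, term by term, the **twisted modular symbols of the twist at EVERY cusp**:

* `modularSymbol_charTwist`: `{∞, r}_{f_χ} = g(χ)⁻¹ ∑_{u mod m} χ(u) {∞, r + u/m}_f` for all `r ∈ ℚ`;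
* `plusSymbol_charTwist_of_even` / `minusSymbol_charTwist_of_even`: for EVEN `χ` the plus (resp.
  minus) symbol of `f_χ` is `g(χ)⁻¹ ∑ χ(u) ·` the plus (resp. minus) symbol of `f` at `r + u/m`;
* `plusSymbol_charTwist_of_odd` / `minusSymbol_charTwist_of_odd`: for ODD `χ` plus and minus are
  exchanged (`{∞, -r}` is reached through `u ↦ -u`, which costs the sign `χ(-1)`).

At `r = 0` the first identity is the classical expression of `L(f ⊗ χ, 1)` through the twisted symbol
sum `∑ χ(a) {∞, a/m}_f` (Birch's formula, Mazur–Tate–Teitelbaum 1986 §I.8 (8.6); tree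
`twisted_LValue_eq`, `ratTwistedSymbolSum_mul_plusPeriod`); the point of this file is the identity at
ALL cusps `r`, which is what transports modular-symbol data (Kurihara numbers, Mazur–Tate elements,
mod-`p` level-lowering identities) from `f` to its quadratic twists. Everything is proved; no named
fact, no new definition.

## References

* G. Shimura, *Introduction to the arithmetic theory of automorphic functions* (1971), Prop. 3.64.
  [Shimura1971]
* B. Mazur, J. Tate, J. Teitelbaum, *On `p`-adic analogues of the conjectures of Birch and
  Swinnerton-Dyer*, Invent. Math. 84 (1986), §I.8 (twisted modular symbols `λ(f, χ; a, m)`).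
  [MazurTateTeitelbaum1986Invent]
* Ju. I. Manin, *Parabolic points and zeta functions of modular curves*, Izv. 6 (1972), §1.5. [Manin1972]
-/

noncomputable section

open scoped MatrixGroups ModularForm Real

open CongruenceSubgroup UpperHalfPlane Complex MeasureTheory

namespace Literature.NumberTheory.EllipticCurves.ModularForms

section TwistSymbol

variable {N : ℕ} {m : ℕ} (L : ℕ)

/-- Translating the vertical ray above `r` by the rational `q`: `q +ᵥ (r + it) = (r + q) + it` in `ℍ`
(`t > 0`). [folklore] -/
private theorem ratCast_vadd_ofComplex_add_mul_I (q r : ℚ) {t : ℝ} (ht : 0 < t) :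
    (((q : ℝ)) +ᵥ ofComplex ((r : ℂ) + t * Complex.I) : ℍ) =
      ofComplex (((r + q : ℚ) : ℂ) + t * Complex.I) := by
  have h1 : 0 < ((r : ℂ) + t * Complex.I).im := by simpa using ht
  have h2 : 0 < (((r + q : ℚ) : ℂ) + t * Complex.I).im := by simpa using ht
  rw [ofComplex_apply_of_im_pos h1, ofComplex_apply_of_im_pos h2]
  ext1
  simp only [coe_vadd, Complex.ofReal_ratCast]
  push_cast
  ring

/-- **The twist along the vertical ray above a cusp**: for `t > 0`,
`f_χ(r + it) = g(χ)⁻¹ ∑_{u mod m} χ(u) f((r + u/m) + it)` (Shimura 1971, Prop. 3.64, evaluated).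
[cite: Shimura1971, Prop. 3.64] -/
theorem charTwist_apply_ofComplex [NeZero N] [NeZero m] [NeZero L] (hN : N ∣ L) (hm : m ^ 2 ∣ L)
    {χ : DirichletCharacter ℂ m} (hχ : χ.IsQuadratic) (f : CuspForm (Gamma0 N) 2) (r : ℚ) {t : ℝ} (ht : 0 < t) :
    charTwist L hN hm hχ f (ofComplex ((r : ℂ) + t * Complex.I)) =
      (gaussSum χ (ZMod.stdAddChar (N := m)))⁻¹ *
        ∑ u : ZMod m, χ u * f (ofComplex (((r + twistShift u : ℚ) : ℂ) + t * Complex.I)) := by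
  have hcoe := congrFun (coe_charTwist L hN hm hχ f) (ofComplex ((r : ℂ) + t * Complex.I))
  rw [hcoe, Pi.smul_apply, coe_twistRaw, Finset.sum_apply, smul_eq_mul, hχ.inv]
  congr 1
  refine Finset.sum_congr rfl fun u _ ↦ ?_
  rw [Pi.smul_apply, smul_eq_mul, slash_twistT_apply, ratCast_vadd_ofComplex_add_mul_I _ _ ht]

/-- **Modular symbols of the twist** (Shimura 1971, Prop. 3.64 integrated along the ray; MTT 1986
§I.8): for a quadratic character `χ mod m` and every `r ∈ ℚ`,
`{∞, r}_{f_χ} = g(χ)⁻¹ ∑_{u mod m} χ(u) {∞, r + u/m}_f`. The integrals converge absolutely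
(`integrableOn_modularSymbol_integrand_holds`), so the finite sum may be taken outside.
[cite: Shimura1971, Prop. 3.64] [cite: MazurTateTeitelbaum1986Invent, §I.8] -/
theorem modularSymbol_charTwist [NeZero N] [NeZero m] [NeZero L] (hN : N ∣ L) (hm : m ^ 2 ∣ L)
    {χ : DirichletCharacter ℂ m} (hχ : χ.IsQuadratic) (f : CuspForm (Gamma0 N) 2) (r : ℚ) :
    modularSymbol (charTwist L hN hm hχ f) r =
      (gaussSum χ (ZMod.stdAddChar (N := m)))⁻¹ *
        ∑ u : ZMod m, χ u * modularSymbol f (r + twistShift u) := by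
  have hint : ∀ u : ZMod m, IntegrableOn
      (fun t : ℝ ↦ χ u * f (ofComplex (((r + twistShift u : ℚ) : ℂ) + t * Complex.I)))
      (Set.Ioi 0) := fun u ↦
    (integrableOn_modularSymbol_integrand_holds f (r + twistShift u)).const_mul (χ u)
  have key : ∫ t in Set.Ioi (0 : ℝ), charTwist L hN hm hχ f (ofComplex ((r : ℂ) + t * Complex.I)) =
      (gaussSum χ (ZMod.stdAddChar (N := m)))⁻¹ *
        ∑ u : ZMod m, χ u * ∫ t in Set.Ioi (0 : ℝ),
          f (ofComplex (((r + twistShift u : ℚ) : ℂ) + t * Complex.I)) := by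
    rw [setIntegral_congr_fun measurableSet_Ioi
      (fun t ht ↦ charTwist_apply_ofComplex L hN hm hχ f r ht), integral_const_mul,
      integral_finsetSum _ (fun u _ ↦ hint u)]
    congr 1
    refine Finset.sum_congr rfl fun u _ ↦ ?_
    exact integral_const_mul _ _
  simp only [modularSymbol]
  rw [key, Finset.mul_sum, Finset.mul_sum, Finset.mul_sum]
  exact Finset.sum_congr rfl fun u _ ↦ by ring

/-- `u/m` and `(-u)/m` (representatives in `[0, 1)`) differ from each other's negatives by an
integer: `twistShift (-u) = -twistShift u + z` with `z ∈ {0, 1}`. [folklore] -/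
private theorem exists_twistShift_neg_eq [NeZero m] (u : ZMod m) :
    ∃ z : ℤ, twistShift (-u) = -twistShift u + z := by
  by_cases hu : u = 0
  · refine ⟨0, ?_⟩
    subst hu
    simp [twistShift]
  · refine ⟨1, ?_⟩
    have hm0 : (m : ℚ) ≠ 0 := by exact_mod_cast (NeZero.ne m)
    rw [twistShift, twistShift, ZMod.neg_val, if_neg hu, Nat.cast_sub (ZMod.val_lt u).le]
    field_simp
    ring

/-- `{∞, -r + (-u)/m}_f = {∞, -(r + u/m)}_f` (the two cusps differ by an integer).
[cite: Manin1972, §1.2] -/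
theorem modularSymbol_neg_add_twistShift_neg [NeZero N] [NeZero m] (f : CuspForm (Gamma0 N) 2) (r : ℚ)
    (u : ZMod m) :
    modularSymbol f (-r + twistShift (-u)) = modularSymbol f (-(r + twistShift u)) := by
  obtain ⟨z, hz⟩ := exists_twistShift_neg_eq u
  rw [hz, show -r + (-twistShift u + (z : ℚ)) = -(r + twistShift u) + z by ring]
  exact modularSymbol_add_intCast_holds f _ z

/-- The `u ↦ -u` re-indexing behind the plus/minus symbols of a twist: for EVEN `χ`,
`∑_u χ(u) {∞, -r + u/m}_f = ∑_u χ(u) {∞, -(r + u/m)}_f`. [cite: MazurTateTeitelbaum1986Invent, §I.8] -/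
theorem sum_mul_modularSymbol_neg_add_of_even [NeZero N] [NeZero m] (f : CuspForm (Gamma0 N) 2)
    {χ : DirichletCharacter ℂ m} (hχe : χ.Even) (r : ℚ) :
    ∑ u : ZMod m, χ u * modularSymbol f (-r + twistShift u) =
      ∑ u : ZMod m, χ u * modularSymbol f (-(r + twistShift u)) := by
  rw [← Equiv.sum_comp (Equiv.neg (ZMod m))]
  refine Finset.sum_congr rfl fun u _ ↦ ?_
  rw [Equiv.neg_apply, modularSymbol_neg_add_twistShift_neg, neg_eq_neg_one_mul u, map_mul,
    hχe, one_mul]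

/-- The same re-indexing for ODD `χ`: `∑_u χ(u) {∞, -r + u/m}_f = -∑_u χ(u) {∞, -(r + u/m)}_f`.
[cite: MazurTateTeitelbaum1986Invent, §I.8] -/
theorem sum_mul_modularSymbol_neg_add_of_odd [NeZero N] [NeZero m] (f : CuspForm (Gamma0 N) 2)
    {χ : DirichletCharacter ℂ m} (hχo : χ.Odd) (r : ℚ) :
    ∑ u : ZMod m, χ u * modularSymbol f (-r + twistShift u) =
      -∑ u : ZMod m, χ u * modularSymbol f (-(r + twistShift u)) := by
  rw [← Equiv.sum_comp (Equiv.neg (ZMod m)), ← Finset.sum_neg_distrib]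
  refine Finset.sum_congr rfl fun u _ ↦ ?_
  rw [Equiv.neg_apply, modularSymbol_neg_add_twistShift_neg, neg_eq_neg_one_mul u, map_mul,
    hχo]
  ring

/-- **Plus symbol of the twist, EVEN `χ`**: `plusSymbol f_χ r = g(χ)⁻¹ ∑_u χ(u) plusSymbol f (r + u/m)`.
[cite: Shimura1971, Prop. 3.64] [cite: MazurTateTeitelbaum1986Invent, §I.8] -/
theorem plusSymbol_charTwist_of_even [NeZero N] [NeZero m] [NeZero L] (hN : N ∣ L) (hm : m ^ 2 ∣ L)
    {χ : DirichletCharacter ℂ m} (hχ : χ.IsQuadratic) (hχe : χ.Even) (f : CuspForm (Gamma0 N) 2) (r : ℚ) :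
    plusSymbol (charTwist L hN hm hχ f) r =
      (gaussSum χ (ZMod.stdAddChar (N := m)))⁻¹ *
        ∑ u : ZMod m, χ u * plusSymbol f (r + twistShift u) := by
  simp only [plusSymbol]
  rw [modularSymbol_charTwist, modularSymbol_charTwist, sum_mul_modularSymbol_neg_add_of_even f hχe,
    ← mul_add, ← Finset.sum_add_distrib, mul_div_assoc, Finset.sum_div]
  congr 1
  exact Finset.sum_congr rfl fun u _ ↦ by ring

/-- **Minus symbol of the twist, EVEN `χ`**: `minusSymbol f_χ r = g(χ)⁻¹ ∑_u χ(u) minusSymbol f (r + u/m)`.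
[cite: Shimura1971, Prop. 3.64] [cite: MazurTateTeitelbaum1986Invent, §I.8] -/
theorem minusSymbol_charTwist_of_even [NeZero N] [NeZero m] [NeZero L] (hN : N ∣ L) (hm : m ^ 2 ∣ L)
    {χ : DirichletCharacter ℂ m} (hχ : χ.IsQuadratic) (hχe : χ.Even) (f : CuspForm (Gamma0 N) 2) (r : ℚ) :
    minusSymbol (charTwist L hN hm hχ f) r =
      (gaussSum χ (ZMod.stdAddChar (N := m)))⁻¹ *
        ∑ u : ZMod m, χ u * minusSymbol f (r + twistShift u) := by
  simp only [minusSymbol]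
  rw [modularSymbol_charTwist, modularSymbol_charTwist, sum_mul_modularSymbol_neg_add_of_even f hχe,
    ← mul_sub, ← Finset.sum_sub_distrib, mul_div_assoc, Finset.sum_div]
  congr 1
  exact Finset.sum_congr rfl fun u _ ↦ by ring

/-- **Plus symbol of the twist, ODD `χ`**: plus and minus are exchanged,
`plusSymbol f_χ r = g(χ)⁻¹ ∑_u χ(u) minusSymbol f (r + u/m)`.
[cite: Shimura1971, Prop. 3.64] [cite: MazurTateTeitelbaum1986Invent, §I.8] -/
theorem plusSymbol_charTwist_of_odd [NeZero N] [NeZero m] [NeZero L] (hN : N ∣ L) (hm : m ^ 2 ∣ L)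
    {χ : DirichletCharacter ℂ m} (hχ : χ.IsQuadratic) (hχo : χ.Odd) (f : CuspForm (Gamma0 N) 2) (r : ℚ) :
    plusSymbol (charTwist L hN hm hχ f) r =
      (gaussSum χ (ZMod.stdAddChar (N := m)))⁻¹ *
        ∑ u : ZMod m, χ u * minusSymbol f (r + twistShift u) := by
  simp only [plusSymbol, minusSymbol]
  rw [modularSymbol_charTwist, modularSymbol_charTwist, sum_mul_modularSymbol_neg_add_of_odd f hχo,
    mul_neg, ← sub_eq_add_neg, ← mul_sub, ← Finset.sum_sub_distrib, mul_div_assoc, Finset.sum_div]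
  congr 1
  exact Finset.sum_congr rfl fun u _ ↦ by ring

/-- **Minus symbol of the twist, ODD `χ`**: `minusSymbol f_χ r = g(χ)⁻¹ ∑_u χ(u) plusSymbol f (r + u/m)`.
[cite: Shimura1971, Prop. 3.64] [cite: MazurTateTeitelbaum1986Invent, §I.8] -/
theorem minusSymbol_charTwist_of_odd [NeZero N] [NeZero m] [NeZero L] (hN : N ∣ L) (hm : m ^ 2 ∣ L)
    {χ : DirichletCharacter ℂ m} (hχ : χ.IsQuadratic) (hχo : χ.Odd) (f : CuspForm (Gamma0 N) 2) (r : ℚ) :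
    minusSymbol (charTwist L hN hm hχ f) r =
      (gaussSum χ (ZMod.stdAddChar (N := m)))⁻¹ *
        ∑ u : ZMod m, χ u * plusSymbol f (r + twistShift u) := by
  simp only [plusSymbol, minusSymbol]
  rw [modularSymbol_charTwist, modularSymbol_charTwist, sum_mul_modularSymbol_neg_add_of_odd f hχo,
    mul_neg, sub_neg_eq_add, ← mul_add, ← Finset.sum_add_distrib, mul_div_assoc, Finset.sum_div]
  congr 1
  exact Finset.sum_congr rfl fun u _ ↦ by ring

end TwistSymbol

end Literature.NumberTheory.EllipticCurves.ModularForms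

end
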